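import Literature.NumberTheory.EllipticCurves.MordellCurveThreeDescent
import HarnessLib

/-!
# The kernel of `a ↦ [C_a] ∈ H¹(K, E_D)` for the Mordell curves `y² = x³ − 3c²`:
# classes dying in `H¹(K, E_D)` come from `E'(K)` through the `φ`-descent map

Topic `NumberTheory/EllipticCurves`. Sequel of `MordellCurveThreeDescent` (the `μ₃`-Kummer torsor
classes `MordellDescent.torsorClass hc hD ha ∈ H¹(K, E_D)`, `D = −3c²`, of `a ∈ K*`), second
milestone of the programme towards `Literature.Barriers.BirchSwinnertonDyer.Cassels1964_sha_threeRank_jZero`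
(Cassels 1964, *Arithmetic on curves of genus 1, VI*), recorded in
`Literature/Barriers/BirchSwinnertonDyer/DescentDefectUnboundedCasselsProofs.lean`. Everything here
is proved; no named facts.

* **The `3`-isogeny `φ : E_D(K̄) → E_{81c²}(K̄)`** with kernel `E_D[φ] = {O, ±T} ≅ μ₃`
  (`MordellDescent.phiGeom`, the tree's Vélu map of `IsVeluThreePair 0 (c√−3)`, file
  `ThreeIsogeny`): `X = (x³ − 12c²)/x²`, `Y = y(x³ + 24c²)/x³` (`veluX_eq`, `veluY_eq`); it is
  defined over `K` (`phiGeom_smul`) and kills `T` (`phiGeom_add_nsmul_torsT`).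
* **The functions `g_{±c} = (y ± 3c)/x`** (`MordellDescent.gFunW`, on the points of ANY
  Weierstrass curve `W` over a field `F` of characteristic `0` forming a Vélu pair
  `IsVeluThreePair 0 (cθ) W W'` with `θ² = −3` — so that the same algebra serves `E_D(K̄)` here and
  the local points `E_D(K̄_v)` later): `g_{±c}³ = Y ∘ φ ± 9c` (`gFunW_pow_three`: the identity
  `(y + 3e)³ = x³ (Y + 9e)` on `y² = x³ − 3c²` for `e² = c²`), and **translation by `T = (0, cθ)`
  multiplies `g_{εc}` by the cube root of unity `(εθ − 1)/2`** (`gFunW_add_T`, from the chord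
  formula `P + T = (2s(s−y)/x², s(y−s)(y−3s)/x³)`, `s = cθ`; iterated in `gFunW_add_nsmul_T`);
  the explicit `φ`-preimage `preimPt` of a point of `W'` with prescribed value of `g_c`
  (`gFunW_preimPt`, `pointFun_preimPt`). These are the cubic analogues of `x(g(v)) = μ²`,
  `μ(v + T) = −μ(v)` and `Q(μ)` in Kramer's `2`-isogeny descent (`KramerDescentShaGProofs`).
* **The `φ`-descent map** `MordellDescent.phiDescent c : E'(K) → K`, `E' = E_{81c²} : Y² = X³ + 81c²`
  (values modulo `K*³`): `O ↦ 1`, `(X, Y) ↦ Y + 9c`, and `−T' = (0, −9c) ↦ (18c)²` — the connecting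
  map `E'(K) → H¹(K, E_D[φ]) = K*/K*³` (cubic analogue of Silverman, *AEC*, X.4.9).
* **The kernel theorem** `MordellDescent.exists_phiDescent_eq_of_torsorClass_eq_zero`: if
  `[C_a] = 0` in `H¹(K, E_D)` then `phiDescent c P' = a w³` for some `P' ∈ E'(K)`, `w ∈ K*`. Proof:
  a coboundary `n_a(σ) T = σ v − v` with `v ∈ E_D[φ]` forces `ω^{−j} ∛a` to be `Γ_K`-fixed, so
  `a ∈ K*³` (`exists_eq_cube_of_kummerExp_eq`); otherwise `P' = φ(v)` is `Γ_K`-invariant, hence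
  rational (`exists_algebraMap_eq_of_forall_galAut`, Galois descent in `K̄/K`), and
  `g_{εc}(v) (∛a)^e` with `(ε, e) = (1, 2)` or `(−1, 1)` is `Γ_K`-fixed with cube
  `(Y(P') + 9εc) a^e` (`exists_pow_three_eq_of_coboundary`).

For Cassels' curves (`K = ℚ`, `D = −432d²`, `c = 12d`, `a = m`) this is the statement "the kernel
consisting of precisely those `m` for which (2) has a rational point" (p. 65) in the form the
counting argument uses it: the `m` with trivial class lie in `δ(E'(ℚ)) · ℚ*³`. What is NOT here:
that `phiDescent` is a homomorphism modulo cubes with kernel `φ(E_D(K))` (the converse inclusion),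
the local conditions, and everything global.

## References

* [Cassels1964ArithmeticVI] J. W. S. Cassels, *Arithmetic on curves of genus 1. VI. The
  Tate–Šafarevič group can be arbitrarily large*, J. reine angew. Math. 214/215 (1964) 65–70,
  p. 65.
* [SilvermanAEC2009] J. H. Silverman, *The Arithmetic of Elliptic Curves*, 2nd ed., GTM 106,
  VIII.§2 and X.4.9 (descent via an isogeny with rational kernel; the `2`-isogeny analogue).
* Template in the tree: `Literature.NumberTheory.EllipticCurves.KramerDescentShaGProofs`
  (`sqClass_mem_range_of_kramerXi_eq_zero`).
-/

noncomputable section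

open scoped Classical

open WeierstrassCurve

universe u

namespace Literature.NumberTheory.EllipticCurves

namespace MordellDescent

variable {K : Type u} [Field K] [CharZero K]

/-! ## Galois descent for elements of `K̄` -/

/-- **Galois descent for elements**: an element of `K̄` fixed by `Γ_K` lies in `K` (`K̄/K` is
Galois, `K` being perfect of characteristic `0`). [folklore] -/
theorem exists_algebraMap_eq_of_forall_galAut {x : AlgebraicClosure K}
    (hx : ∀ σ : Field.absoluteGaloisGroup K, galAut σ x = x) :
    ∃ b : K, algebraMap K (AlgebraicClosure K) b = x := by
  haveI : Algebra.IsAlgebraic K (AlgebraicClosure K) := IsAlgClosure.isAlgebraic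
  haveI : Algebra.IsSeparable K (AlgebraicClosure K) := Algebra.IsAlgebraic.isSeparable_of_perfectField
  haveI : Normal K (AlgebraicClosure K) := IsAlgClosure.normal K (AlgebraicClosure K)
  haveI : IsGalois K (AlgebraicClosure K) := {}
  exact (InfiniteGalois.mem_range_algebraMap_iff_fixed x).mpr fun σ => hx σ

variable {D c : K}

/-! ## Point-level algebra of the Vélu pair `(W, W')`, `W : y² = x³ − 3c²`, `T = (0, cθ)`, `θ² = −3` -/

section PointAlgebra

variable {F : Type u} [Field F] {W W' : WeierstrassCurve F} {e c θ ε : F}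

/-- For a Vélu pair with parameters `(0, cθ)`, `θ² = −3`, the equation of `W` reads
`y² = x³ − 3c²`. [folklore] -/
theorem IsVeluPair.equation_iff' (hV : IsVeluThreePair 0 (c * θ) W W') (hθ : θ ^ 2 = -3) (x y : F) :
    W.toAffine.Equation x y ↔ y ^ 2 = x ^ 3 - 3 * c ^ 2 := by
  rw [hV.equation_iff]
  constructor
  · intro h; linear_combination h + c ^ 2 * hθ
  · intro h; linear_combination h - c ^ 2 * hθ

/-- The `x`-coordinate of the `3`-isogeny: `X(x) = (x³ + 4s²)/x² = (x³ − 12c²)/x²`. [folklore] -/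
theorem IsVeluPair.X_eq' (hV : IsVeluThreePair 0 (c * θ) W W') (hθ : θ ^ 2 = -3) (x : F) :
    hV.X x = (x ^ 3 - 12 * c ^ 2) / x ^ 2 := by
  unfold IsVeluThreePair.X
  congr 1
  linear_combination (4 * c ^ 2) * hθ

/-- The `y`-coordinate of the `3`-isogeny: `Y(x, y) = y(x³ − 8s²)/x³ = y(x³ + 24c²)/x³`.
[folklore] -/
theorem IsVeluPair.Y_eq' (hV : IsVeluThreePair 0 (c * θ) W W') (hθ : θ ^ 2 = -3) (x y : F) :
    hV.Y x y = y * (x ^ 3 + 24 * c ^ 2) / x ^ 3 := by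
  unfold IsVeluThreePair.Y
  congr 1
  linear_combination (-8 * y * c ^ 2) * hθ

/-- The functions `g_e = (y + 3e)/x` on the points of `W` (`e = ±c`; value `0` at `O` and, by
`x/0 = 0`, at `±T`): `g_{±c}` is a cube root of `Y ∘ φ ± 9c` (`gFunW_pow_three`) on which
translation by `T` acts by a primitive cube root of unity (`gFunW_add_T`) — the functions through
which the `φ`-descent map `(X, Y) ↦ Y ± 9c` is read off on `W`. [folklore] -/
def gFunW (e : F) : W.toAffine.Point → F
  | .zero => 0
  | .some x y _ => (y + 3 * e) / x

/-- `g_e` at an affine point. [folklore] -/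
@[simp] theorem gFunW_some (e : F) {x y : F} (h : W.toAffine.Nonsingular x y) :
    gFunW e (Affine.Point.some x y h) = (y + 3 * e) / x := rfl

/-- `g_e(O) = 0`. [folklore] -/
@[simp] theorem gFunW_zero (e : F) : gFunW e (0 : W.toAffine.Point) = 0 := rfl

/-- **`g_e³ = Y ∘ φ + 9e`** off the kernel, for `e² = c²`: the identity
`(y + 3e)³ = x³ (Y(x,y) + 9e)` on `y² = x³ − 3c²`. [folklore] -/
theorem gFunW_pow_three (hV : IsVeluThreePair 0 (c * θ) W W') (hθ : θ ^ 2 = -3) (he : e ^ 2 = c ^ 2)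
    {x y : F} (h : W.toAffine.Nonsingular x y) (hx : x ≠ 0) :
    gFunW e (Affine.Point.some x y h) ^ 3 = hV.Y x y + 9 * e := by
  have hE := (IsVeluPair.equation_iff' hV hθ x y).mp h.left
  rw [gFunW_some, IsVeluPair.Y_eq' hV hθ, div_pow, div_add' _ _ _ (pow_ne_zero 3 hx),
    div_eq_div_iff (pow_ne_zero 3 hx) (pow_ne_zero 3 hx)]
  linear_combination (x ^ 3 * (y + 9 * e)) * hE + (x ^ 3 * 27 * (y + e)) * he

/-- `g_c g_{−c} = X ∘ φ` off the kernel: `(y + 3c)(y − 3c)/x² = (x³ − 12c²)/x²`. [folklore] -/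
theorem gFunW_mul_gFunW_neg (hV : IsVeluThreePair 0 (c * θ) W W') (hθ : θ ^ 2 = -3)
    {x y : F} (h : W.toAffine.Nonsingular x y) (hx : x ≠ 0) :
    gFunW c (Affine.Point.some x y h) * gFunW (-c) (Affine.Point.some x y h) = hV.X x := by
  have hE := (IsVeluPair.equation_iff' hV hθ x y).mp h.left
  rw [gFunW_some, gFunW_some, IsVeluPair.X_eq' hV hθ, div_mul_div_comm, ← pow_two,
    div_eq_div_iff (pow_ne_zero 2 hx) (pow_ne_zero 2 hx)]
  linear_combination x ^ 2 * hE

variable [CharZero F]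

/-- `2 ≠ 0`, `cθ ≠ 0` bookkeeping: `θ ≠ 0`. [folklore] -/
theorem theta_ne_zero' (hθ : θ ^ 2 = -3) : θ ≠ 0 := by
  rintro rfl; norm_num at hθ

/-- **Translation by `T = (0, cθ)` multiplies `g_{εc}` by the cube root of unity `(εθ − 1)/2`**
(`ε = ±1`): `g_{εc}(P + T) = ((εθ − 1)/2) g_{εc}(P)` for every point `P` of `W` (on the kernel
`{O, ±T}` both sides vanish). The computation: `P + T = (2s(s−y)/x², s(y−s)(y−3s)/x³)` for
`P = (x, y)`, `s = cθ` (chord through `T`). [folklore] -/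
theorem gFunW_add_T (hV : IsVeluThreePair 0 (c * θ) W W') (hθ : θ ^ 2 = -3) (hc : c ≠ 0)
    (hε : ε ^ 2 = 1) (P : W.toAffine.Point) :
    gFunW (ε * c) (P + hV.T) = (ε * θ - 1) / 2 * gFunW (ε * c) P := by
  have hs0 : c * θ ≠ 0 := mul_ne_zero hc (theta_ne_zero' hθ)
  rcases P with _ | ⟨x, y, hxy⟩
  · rw [← Affine.Point.zero_def, zero_add, gFunW_zero, mul_zero, IsVeluThreePair.T, gFunW_some, div_zero]
  · by_cases hx : x = 0
    · -- `P = ±T`, `P + T ∈ {−T, O}`: both sides vanish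
      have h0 : gFunW (ε * c) (Affine.Point.some x y hxy) = 0 := by rw [gFunW_some, hx, div_zero]
      rw [h0, mul_zero]
      rcases hV.some_eq_T_or hxy hx with hP | hP <;> rw [hP]
      · rw [hV.T_add_T, hV.neg_T, gFunW_some, div_zero]
      · rw [neg_add_cancel, gFunW_zero]
    · obtain ⟨hQ, hadd⟩ := hV.T_add_some hxy hx
      rw [add_comm, hadd, gFunW_some, gFunW_some]
      set L := (c * θ - y) / (0 - x) with hL
      have hE := (IsVeluPair.equation_iff' hV hθ x y).mp hxy.left
      have hLx : L * x = y - c * θ := by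
        rw [hL]; field_simp; ring
      -- `X₃ x² = 2s(s − y)`, so `X₃ ≠ 0`
      have hX3 : (L ^ 2 - (0 : F) ^ 2 - 0 - x) * x ^ 2 = 2 * (c * θ) * (c * θ - y) := by
        have e1 : (L ^ 2 - (0 : F) ^ 2 - 0 - x) * x ^ 2 = (L * x) ^ 2 - x ^ 3 := by ring
        rw [e1, hLx]
        linear_combination hE - c ^ 2 * hθ
      have hX3ne : L ^ 2 - (0 : F) ^ 2 - 0 - x ≠ 0 := by
        intro h0
        rw [h0, zero_mul, eq_comm, mul_eq_zero] at hX3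
        rcases hX3 with h1 | h1
        · exact (mul_ne_zero two_ne_zero hs0) h1
        · have hy : y = c * θ := (sub_eq_zero.mp h1).symm
          apply hx
          have : x ^ 3 = 0 := by
            rw [hy] at hE
            linear_combination -hE + c ^ 2 * hθ
          exact pow_eq_zero_iff (n := 3) (by norm_num) |>.mp this
      rw [mul_div_assoc', div_eq_div_iff hX3ne hx]
      apply mul_left_cancel₀ (pow_ne_zero 2 hx)
      have e1 : x ^ 2 * ((-(L * (L ^ 2 - (0 : F) ^ 2 - 0 - x - 0) + c * θ) + 3 * (ε * c)) * x) =
          -(L * x) ^ 3 + (L * x) * x ^ 3 - (c * θ - 3 * (ε * c)) * x ^ 3 := by ring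
      have e2 : x ^ 2 * ((ε * θ - 1) / 2 * (y + 3 * (ε * c)) * (L ^ 2 - (0 : F) ^ 2 - 0 - x)) =
          (ε * θ - 1) / 2 * (y + 3 * (ε * c)) * ((L * x) ^ 2 - x ^ 3) := by ring
      rw [e1, e2, hLx]
      linear_combination
        (-(y - 2 * (c * θ) + 3 * (ε * c) + (ε * θ - 1) / 2 * (y + 3 * (ε * c)))) * hE +
        ((y - c * θ) * (ε * c) * y +
          c ^ 2 * (y - 2 * (c * θ) + 3 * (ε * c) + (ε * θ - 1) / 2 * (y + 3 * (ε * c)))) * hθ +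
        (3 * c ^ 2 * θ ^ 2 * (y - c * θ)) * hε

/-- Iterating `gFunW_add_T`: `g_{εc}(P + kT) = ((εθ − 1)/2)^k g_{εc}(P)`. [folklore] -/
theorem gFunW_add_nsmul_T (hV : IsVeluThreePair 0 (c * θ) W W') (hθ : θ ^ 2 = -3) (hc : c ≠ 0)
    (hε : ε ^ 2 = 1) (P : W.toAffine.Point) (k : ℕ) :
    gFunW (ε * c) (P + k • hV.T) = ((ε * θ - 1) / 2) ^ k * gFunW (ε * c) P := by
  induction k with
  | zero => rw [zero_smul, add_zero, pow_zero, one_mul]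
  | succ k ih => rw [succ_nsmul, ← add_assoc, gFunW_add_T hV hθ hc hε, ih, pow_succ]; ring

/-! ### The explicit `φ`-preimage with prescribed `g_c` -/

/-- For `P' = (X₀, Y₀)` on `W' : Y² = X³ + 81c²` and a cube root `γ` of `Y₀ + 9c ≠ 0`, put
`γ' = X₀/γ` (a cube root of `Y₀ − 9c`); the point `(6c/(γ − γ'), γ·6c/(γ − γ') − 3c)` of `W` is the
`φ`-preimage of `P'` with `g_c = γ`, `g_{−c} = γ'`: its `x`-coordinate. [folklore] -/
def preimX (c X₀ γ : F) : F := 6 * c / (γ - X₀ / γ)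

/-- The `y`-coordinate `γ x − 3c` of the explicit `φ`-preimage. [folklore] -/
def preimY (c X₀ γ : F) : F := γ * preimX c X₀ γ - 3 * c

/-- `(γ − γ')³ + 3X₀(γ − γ') − 18c = 0` for `γ³ = Y₀ + 9c`, `γ' = X₀/γ`, `Y₀² = X₀³ + 81c²`.
[folklore] -/
theorem preim_cubic {X₀ Y₀ γ : F} (hγ : γ ^ 3 = Y₀ + 9 * c) (hγ0 : γ ≠ 0)
    (hE' : Y₀ ^ 2 = X₀ ^ 3 + 81 * c ^ 2) :
    (γ - X₀ / γ) ^ 3 + 3 * X₀ * (γ - X₀ / γ) - 18 * c = 0 := by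
  have hγ' : (X₀ / γ) ^ 3 = Y₀ - 9 * c := by
    rw [div_pow, div_eq_iff (pow_ne_zero 3 hγ0), hγ]
    linear_combination -hE'
  have hγγ' : γ * (X₀ / γ) = X₀ := mul_div_cancel₀ _ hγ0
  linear_combination hγ - hγ' - 3 * (γ - X₀ / γ) * hγγ'

/-- `γ ≠ γ'` (else `18c = 0`). [folklore] -/
theorem preim_sub_ne_zero (hc : c ≠ 0) {X₀ Y₀ γ : F} (hγ : γ ^ 3 = Y₀ + 9 * c) (hγ0 : γ ≠ 0)
    (hE' : Y₀ ^ 2 = X₀ ^ 3 + 81 * c ^ 2) : γ - X₀ / γ ≠ 0 := by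
  intro h0
  have := preim_cubic hγ hγ0 hE'
  rw [h0] at this
  have h18 : (18 : F) * c = 0 := by linear_combination -this
  exact (mul_ne_zero (by norm_num) hc) h18

/-- `x ≠ 0` for the explicit preimage. [folklore] -/
theorem preimX_ne_zero (hc : c ≠ 0) {X₀ Y₀ γ : F} (hγ : γ ^ 3 = Y₀ + 9 * c) (hγ0 : γ ≠ 0)
    (hE' : Y₀ ^ 2 = X₀ ^ 3 + 81 * c ^ 2) : preimX c X₀ γ ≠ 0 :=
  div_ne_zero (mul_ne_zero (by norm_num) hc) (preim_sub_ne_zero hc hγ hγ0 hE')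

/-- **The explicit preimage lies on `W`**: `y² = x³ − 3c²`. [folklore] -/
theorem preim_equation (hc : c ≠ 0) {X₀ Y₀ γ : F} (hγ : γ ^ 3 = Y₀ + 9 * c) (hγ0 : γ ≠ 0)
    (hE' : Y₀ ^ 2 = X₀ ^ 3 + 81 * c ^ 2) :
    preimY c X₀ γ ^ 2 = preimX c X₀ γ ^ 3 - 3 * c ^ 2 := by
  have hδ := preim_sub_ne_zero hc hγ hγ0 hE'
  have hcub := preim_cubic hγ hγ0 hE'
  have hγγ' : γ * (X₀ / γ) = X₀ := mul_div_cancel₀ _ hγ0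
  -- `x (γ − γ') = 6c`
  have hx : preimX c X₀ γ * (γ - X₀ / γ) = 6 * c := by
    unfold preimX; exact div_mul_cancel₀ _ hδ
  unfold preimY
  -- `x³ − X₀ x² − 12c² = 0`, from `(γ − γ')³ + 3X₀(γ − γ') − 18c = 0` multiplied by `x³`
  have h3 : preimX c X₀ γ ^ 3 * ((γ - X₀ / γ) ^ 3 + 3 * X₀ * (γ - X₀ / γ) - 18 * c) = 0 := by
    rw [hcub, mul_zero]
  have h4 : preimX c X₀ γ ^ 3 * ((γ - X₀ / γ) ^ 3 + 3 * X₀ * (γ - X₀ / γ) - 18 * c) =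
      (preimX c X₀ γ * (γ - X₀ / γ)) ^ 3 + 3 * X₀ * preimX c X₀ γ ^ 2 * (preimX c X₀ γ * (γ - X₀ / γ)) -
        18 * c * preimX c X₀ γ ^ 3 := by
    ring
  rw [h4, hx] at h3
  have h5 : (18 * c) * (12 * c ^ 2 + X₀ * preimX c X₀ γ ^ 2 - preimX c X₀ γ ^ 3) = 0 := by
    linear_combination h3
  have h6 : 12 * c ^ 2 + X₀ * preimX c X₀ γ ^ 2 - preimX c X₀ γ ^ 3 = 0 :=
    (mul_eq_zero.mp h5).resolve_left (mul_ne_zero (by norm_num) hc)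
  -- `(γx − 3c)² = (γx)(γ'x) + 9c²` with `γ'x = γx − 6c`, `γγ' = X₀`
  linear_combination (γ * preimX c X₀ γ) * hx + preimX c X₀ γ ^ 2 * hγγ' + h6

/-- `g_c` of the explicit preimage is `γ`. [folklore] -/
theorem gFunW_preim (hc : c ≠ 0) {X₀ Y₀ γ : F} (hγ : γ ^ 3 = Y₀ + 9 * c) (hγ0 : γ ≠ 0)
    (hE' : Y₀ ^ 2 = X₀ ^ 3 + 81 * c ^ 2) (h : W.toAffine.Nonsingular (preimX c X₀ γ) (preimY c X₀ γ)) :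
    gFunW c (Affine.Point.some _ _ h) = γ := by
  rw [gFunW_some, preimY, sub_add_cancel, mul_div_assoc, div_self (preimX_ne_zero hc hγ hγ0 hE'), mul_one]

/-- `g_{−c}` of the explicit preimage is `γ' = X₀/γ`. [folklore] -/
theorem gFunW_neg_preim (hc : c ≠ 0) {X₀ Y₀ γ : F} (hγ : γ ^ 3 = Y₀ + 9 * c) (hγ0 : γ ≠ 0)
    (hE' : Y₀ ^ 2 = X₀ ^ 3 + 81 * c ^ 2) (h : W.toAffine.Nonsingular (preimX c X₀ γ) (preimY c X₀ γ)) :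
    gFunW (-c) (Affine.Point.some _ _ h) = X₀ / γ := by
  have hδ := preim_sub_ne_zero hc hγ hγ0 hE'
  have hx0 := preimX_ne_zero hc hγ hγ0 hE'
  have hx : preimX c X₀ γ * (γ - X₀ / γ) = 6 * c := by
    unfold preimX; exact div_mul_cancel₀ _ hδ
  rw [gFunW_some, preimY, div_eq_iff hx0]
  linear_combination hx

/-- **`φ` of the explicit preimage is `P' = (X₀, Y₀)`.** [folklore] -/
theorem pointFun_preim (hV : IsVeluThreePair 0 (c * θ) W W') (hθ : θ ^ 2 = -3) (hc : c ≠ 0)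
    {X₀ Y₀ γ : F} (hγ : γ ^ 3 = Y₀ + 9 * c) (hγ0 : γ ≠ 0) (hE' : Y₀ ^ 2 = X₀ ^ 3 + 81 * c ^ 2)
    (h : W.toAffine.Nonsingular (preimX c X₀ γ) (preimY c X₀ γ)) (h' : W'.toAffine.Nonsingular X₀ Y₀) :
    hV.pointFun (Affine.Point.some _ _ h) = Affine.Point.some X₀ Y₀ h' := by
  have hx0 := preimX_ne_zero hc hγ hγ0 hE'
  rw [hV.pointFun_some _ hx0]
  simp only [Affine.Point.some.injEq]
  constructor
  · rw [← gFunW_mul_gFunW_neg hV hθ h hx0, gFunW_preim hc hγ hγ0 hE', gFunW_neg_preim hc hγ hγ0 hE',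
      mul_div_cancel₀ _ hγ0]
  · have h3 := gFunW_pow_three hV hθ (e := c) rfl h hx0
    rw [gFunW_preim hc hγ hγ0 hE', hγ] at h3
    linear_combination -h3

end PointAlgebra

/-! ## The `3`-isogeny `φ : E_D → E_{81c²}` on geometric points -/

section Isogeny

variable (hc : c ≠ 0) (hD : D = -3 * c ^ 2)

/-- Shorthand: `c` as an element of `K̄`. [folklore] -/
def cbar (c : K) : AlgebraicClosure K := algebraMap K (AlgebraicClosure K) c

omit [CharZero K] in
/-- `Γ_K` fixes `c ∈ K`. [folklore] -/
@[simp] theorem galAut_cbar (σ : Field.absoluteGaloisGroup K) : galAut σ (cbar c) = cbar c :=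
  AlgEquiv.commutes _ c

omit [CharZero K] in
/-- `s = c √−3` (definitional). [folklore] -/
theorem sCoord_eq (c : K) : sCoord c = cbar c * theta K := rfl

omit [CharZero K] in
/-- `c ≠ 0` in `K̄`. [folklore] -/
theorem cbar_ne_zero (hc : c ≠ 0) : cbar c ≠ 0 :=
  (map_ne_zero_iff _ (algebraMap K (AlgebraicClosure K)).injective).mpr hc

/-- The Vélu pair of `MordellCurveThreeDescent` in the form `IsVeluThreePair 0 (c̄ θ)` used by the
point-level algebra above. [folklore] -/
theorem isVeluThreePair_mordell' (hc : c ≠ 0) (hD : D = -3 * c ^ 2) :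
    IsVeluThreePair (0 : AlgebraicClosure K) (cbar c * theta K)
      ((mordellCurve D).baseChange (AlgebraicClosure K))
      ((mordellCurve (81 * c ^ 2)).baseChange (AlgebraicClosure K)) :=
  isVeluThreePair_mordell hc hD

/-- `Γ_K` commutes with `X`. [folklore] -/
theorem galAut_veluX (σ : Field.absoluteGaloisGroup K) (x : AlgebraicClosure K) :
    galAut σ ((isVeluThreePair_mordell' hc hD).X x) =
      (isVeluThreePair_mordell' hc hD).X (galAut σ x) := by
  simp only [IsVeluPair.X_eq' (isVeluThreePair_mordell' hc hD) (theta_sq K), map_div₀, map_sub, map_pow,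
    map_mul, map_ofNat, galAut_cbar]

/-- `Γ_K` commutes with `Y`. [folklore] -/
theorem galAut_veluY (σ : Field.absoluteGaloisGroup K) (x y : AlgebraicClosure K) :
    galAut σ ((isVeluThreePair_mordell' hc hD).Y x y) =
      (isVeluThreePair_mordell' hc hD).Y (galAut σ x) (galAut σ y) := by
  simp only [IsVeluPair.Y_eq' (isVeluThreePair_mordell' hc hD) (theta_sq K), map_div₀, map_add, map_pow,
    map_mul, map_ofNat, galAut_cbar]

/-- **The `3`-isogeny `φ : E_D(K̄) → E_{81c²}(K̄)`** (the tree's Vélu map of the pair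
`isVeluThreePair_mordell`), an additive homomorphism with kernel `{O, ±T}`. [folklore] -/
def phiGeom : geomPoints (mordellCurve D) →+ geomPoints (mordellCurve (81 * c ^ 2)) :=
  (isVeluThreePair_mordell' hc hD).pointHom

/-- Unfolding `phiGeom`. [folklore] -/
theorem phiGeom_apply (P : geomPoints (mordellCurve D)) :
    phiGeom hc hD P = (isVeluThreePair_mordell' hc hD).pointFun P := rfl

/-- `φ(T) = O`. [folklore] -/
theorem phiGeom_torsT : phiGeom hc hD (torsT hc hD) = 0 :=
  (isVeluThreePair_mordell' hc hD).pointFun_T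

/-- `φ(P + kT) = φ(P)`. [folklore] -/
theorem phiGeom_add_nsmul_torsT (P : geomPoints (mordellCurve D)) (k : ℕ) :
    phiGeom hc hD (P + k • torsT hc hD) = phiGeom hc hD P := by
  rw [map_add, map_nsmul, phiGeom_torsT, smul_zero, add_zero]

/-- **`φ` is defined over `K`**: it commutes with `Γ_K` (its coefficients `12c², 24c²` lie in `K`).
[folklore] -/
theorem phiGeom_smul (σ : Field.absoluteGaloisGroup K) (P : geomPoints (mordellCurve D)) :
    phiGeom hc hD (σ • P) = σ • phiGeom hc hD P := by
  have hV := isVeluThreePair_mordell' hc hD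
  rcases P with _ | ⟨x, y, hxy⟩
  · change phiGeom hc hD (σ • (0 : geomPoints (mordellCurve D))) = σ • phiGeom hc hD 0
    rw [smul_zero, map_zero, smul_zero]
  · rw [phiGeom_apply, phiGeom_apply,
      smul_geomPoints_some σ hxy (nonsingular_galAut σ hxy)]
    by_cases hx : x = 0
    · have hσx : galAut σ x = 0 := by rw [hx, map_zero]
      rw [hV.pointFun_some_of_eq_zero _ hσx, hV.pointFun_some_of_eq_zero _ hx]
      show (0 : geomPoints (mordellCurve (81 * c ^ 2))) =
        σ • (0 : geomPoints (mordellCurve (81 * c ^ 2)))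
      rw [smul_zero]
    · have hσx : galAut σ x ≠ 0 := (map_ne_zero _).mpr hx
      rw [hV.pointFun_some _ hσx, hV.pointFun_some _ hx,
        smul_geomPoints_some σ _ (nonsingular_galAut σ (hV.nonsingular_image hxy hx))]
      exact point_some_ext (galAut_veluX hc hD σ x).symm (galAut_veluY hc hD σ x y).symm

omit [CharZero K] in
/-- `g_e` on `E_D(K̄)` is Galois-compatible when `σ e = e`: `σ(g_e(P)) = g_e(σP)`. [folklore] -/
theorem galAut_gFunW (σ : Field.absoluteGaloisGroup K) {e : AlgebraicClosure K} (he : galAut σ e = e)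
    (P : geomPoints (mordellCurve D)) :
    galAut σ (gFunW e P) = gFunW e (σ • P) := by
  rcases P with _ | ⟨x, y, hxy⟩
  · change galAut σ 0 = gFunW e (σ • (0 : geomPoints (mordellCurve D)))
    rw [smul_zero, map_zero]; rfl
  · rw [smul_geomPoints_some σ hxy (nonsingular_galAut σ hxy), gFunW_some, gFunW_some, map_div₀,
      map_add, map_mul, map_ofNat, he]

/-- Translation by `torsT` on `E_D(K̄)` multiplies `g_{εc̄}` by `(εθ − 1)/2` (the geometric case of
`gFunW_add_nsmul_T`). [folklore] -/
theorem gFunW_add_nsmul_torsT {ε : AlgebraicClosure K} (hε : ε ^ 2 = 1)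
    (P : geomPoints (mordellCurve D)) (k : ℕ) :
    gFunW (ε * cbar c) (P + k • torsT hc hD) = ((ε * theta K - 1) / 2) ^ k * gFunW (ε * cbar c) P :=
  gFunW_add_nsmul_T (isVeluThreePair_mordell' hc hD) (theta_sq K) (cbar_ne_zero hc) hε P k

end Isogeny

/-! ## The kernel of `a ↦ [C_a]`: classes dying in `H¹(K, E_D)` come from `E'(K)` -/

section Kernel

variable (hc : c ≠ 0) (hD : D = -3 * c ^ 2)

/-- `chiT k = k T` for `k ∈ ℕ`. [folklore] -/
theorem chiT_natCast (k : ℕ) : chiT hc hD (k : ZMod 3) = k • torsT hc hD := by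
  rw [← Int.cast_natCast, chiT_intCast, natCast_zsmul]

/-- `chiT n = n.val • T`. [folklore] -/
theorem chiT_eq_val_nsmul (n : ZMod 3) : chiT hc hD n = n.val • torsT hc hD := by
  conv_lhs => rw [← ZMod.natCast_zmod_val n]
  exact chiT_natCast hc hD n.val

/-- `n ↦ nT` is injective on `ℤ/3ℤ` (`T` has order `3`). [folklore] -/
theorem chiT_injective : Function.Injective (chiT hc hD) := by
  have hT := torsT_ne_zero hc hD
  refine (injective_iff_map_eq_zero _).mpr fun n hn => ?_
  rw [chiT_eq_val_nsmul] at hn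
  have hlt := n.val_lt
  have h3 : n.val = 0 ∨ n.val = 1 ∨ n.val = 2 := by omega
  rcases h3 with h0 | h1 | h2
  · exact (ZMod.val_eq_zero n).mp h0
  · rw [h1, one_nsmul] at hn
    exact absurd hn hT
  · rw [h2, two_nsmul, torsT_add_torsT, neg_eq_zero] at hn
    exact absurd hn hT

/-- **Cocycles cohomologous to zero through a multiple of `T` come from cubes**: if
`kummerExp a σ = (eps σ − 1) j` for all `σ` then `ω^{−j} ∛a` is `Γ_K`-fixed, so `a ∈ K*³`.
[folklore] -/
theorem exists_eq_cube_of_kummerExp_eq {a : K} (ha : a ≠ 0) {j : ZMod 3}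
    (h : ∀ σ : Field.absoluteGaloisGroup K, kummerExp a σ = (eps σ - 1) * j) :
    ∃ b : K, b ≠ 0 ∧ a = b ^ 3 := by
  set α' : AlgebraicClosure K := omega K ^ (-j).val * cubeRoot a with hα'
  have hfix : ∀ σ : Field.absoluteGaloisGroup K, galAut σ α' = α' := by
    intro σ
    rw [hα', map_mul, galAut_omega_pow, galAut_cubeRoot ha σ, ← mul_assoc, ← pow_add]
    congr 1
    rw [omega_pow_eq_pow_iff]
    push_cast
    rw [epsNat_cast, ZMod.natCast_zmod_val, ZMod.natCast_zmod_val, h σ]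
    ring
  obtain ⟨b, hb⟩ := exists_algebraMap_eq_of_forall_galAut hfix
  have hb3 : algebraMap K (AlgebraicClosure K) (b ^ 3) = algebraMap K (AlgebraicClosure K) a := by
    rw [map_pow, hb, hα', mul_pow, ← pow_mul, mul_comm (-j).val 3, pow_mul, omega_pow_three, one_pow,
      one_mul, cubeRoot_pow_three]
  have hab : a = b ^ 3 := ((algebraMap K (AlgebraicClosure K)).injective hb3).symm
  refine ⟨b, ?_, hab⟩
  rintro rfl
  exact ha (by rw [hab]; ring)

/-- **The `φ`-descent map on `E'(K)`**, `E' = E_{81c²} : Y² = X³ + 81c²`, read in `K`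
(values to be taken modulo `K*³`): `O ↦ 1`, `(X, Y) ↦ Y + 9c`, except at `−T' = (0, −9c)` where
`Y + 9c = 0` and the value is `(Y − 9c)² = (18c)²` (`(Y + 9c)(Y − 9c) = X³`, so `Y + 9c ≡ (Y − 9c)²`
modulo cubes wherever both are non-zero). The connecting homomorphism
`E'(K) → H¹(K, E_D[φ]) = K*/K*³` of the isogeny `φ` with kernel `μ₃` — the cubic analogue of
`(X, Y) ↦ X` for a `2`-isogeny with kernel `(0,0)` (Silverman, *AEC*, X.4.9).
[cite: SilvermanAEC2009, X.4.9] -/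
def phiDescent (c : K) : (mordellCurve (81 * c ^ 2)).toAffine.Point → K
  | .zero => 1
  | .some _ Y _ => if Y = -(9 * c) then (18 * c) ^ 2 else Y + 9 * c

omit [CharZero K] in
/-- `phiDescent c O = 1`. [folklore] -/
@[simp] theorem phiDescent_zero (c : K) : phiDescent c (0 : (mordellCurve (81 * c ^ 2)).toAffine.Point) = 1 :=
  rfl

omit [CharZero K] in
/-- `phiDescent` at an affine point. [folklore] -/
theorem phiDescent_some (c : K) {X Y : K} (h : (mordellCurve (81 * c ^ 2)).toAffine.Nonsingular X Y) :
    phiDescent c (Affine.Point.some X Y h) = if Y = -(9 * c) then (18 * c) ^ 2 else Y + 9 * c :=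
  rfl

/-- From the coboundary equation `n(σ) T = σ v − v`: `σ v = v + n(σ) T`. [folklore] -/
theorem smul_eq_add_of_torsorFun_eq {a : K} {v : geomPoints (mordellCurve D)}
    (hv : ∀ σ : Field.absoluteGaloisGroup K, torsorFun hc hD a σ = σ • v - v)
    (σ : Field.absoluteGaloisGroup K) : σ • v = v + (kummerExp a σ).val • torsT hc hD := by
  have h := hv σ
  rw [torsorFun, chiT_eq_val_nsmul] at h
  rw [h, add_sub_cancel]

/-- **The `g`-function argument.** If `σ v = v + n_a(σ) T` for an affine `v = (x, y) ∉ E_D[φ]`, and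
`ε = ±1` with `(ε√−3 − 1)/2 = ω^m`, `m + e = 3`, then `g_{εc}(v) · (∛a)^e` is `Γ_K`-fixed (both
factors are moved by powers of `ω` with exponents `m n_a(σ)` and `e n_a(σ)`), hence lies in `K`,
and its cube is `(Y(φ v) + 9εc) a^e`. [folklore] -/
theorem exists_pow_three_eq_of_coboundary {a : K} (ha : a ≠ 0) {x y : AlgebraicClosure K}
    (hxy : ((mordellCurve D).baseChange (AlgebraicClosure K)).toAffine.Nonsingular x y) (hx : x ≠ 0)
    {v : geomPoints (mordellCurve D)} (hv : v = Affine.Point.some x y hxy)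
    (hσv : ∀ σ : Field.absoluteGaloisGroup K, σ • v = v + (kummerExp a σ).val • torsT hc hD)
    {ε : AlgebraicClosure K} (hε : ε ^ 2 = 1) (hεfix : ∀ σ : Field.absoluteGaloisGroup K, galAut σ ε = ε)
    {m e : ℕ} (hm : (ε * theta K - 1) / 2 = omega K ^ m) (hme : m + e = 3) :
    ∃ w : K, algebraMap K (AlgebraicClosure K) w ^ 3 =
      ((isVeluThreePair_mordell' hc hD).Y x y + 9 * (ε * cbar c)) *
        algebraMap K (AlgebraicClosure K) a ^ e := by
  set g := gFunW (ε * cbar c) v with hg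
  have he2 : (ε * cbar c) ^ 2 = cbar c ^ 2 := by rw [mul_pow, hε, one_mul]
  have hg3 : g ^ 3 = (isVeluThreePair_mordell' hc hD).Y x y + 9 * (ε * cbar c) := by
    rw [hg, hv]; exact gFunW_pow_three (isVeluThreePair_mordell' hc hD) (theta_sq K) he2 hxy hx
  have hσg : ∀ σ : Field.absoluteGaloisGroup K,
      galAut σ g = omega K ^ (m * (kummerExp a σ).val) * g := by
    intro σ
    have hfixe : galAut σ (ε * cbar c) = ε * cbar c := by rw [map_mul, hεfix, galAut_cbar]
    rw [hg, galAut_gFunW σ hfixe, hσv σ, gFunW_add_nsmul_torsT hc hD hε, hm, ← pow_mul]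
  set wt := g * cubeRoot a ^ e with hwt
  have hfix : ∀ σ : Field.absoluteGaloisGroup K, galAut σ wt = wt := by
    intro σ
    have h3 : m * (kummerExp a σ).val + (kummerExp a σ).val * e = 3 * (kummerExp a σ).val := by
      rw [mul_comm m, ← mul_add, hme, mul_comm]
    have hω : omega K ^ (m * (kummerExp a σ).val) * omega K ^ ((kummerExp a σ).val * e) = 1 := by
      rw [← pow_add, h3, pow_mul, omega_pow_three, one_pow]
    rw [hwt, map_mul, map_pow, hσg σ, galAut_cubeRoot ha σ, mul_pow, ← pow_mul]
    calc omega K ^ (m * (kummerExp a σ).val) * g *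
          (omega K ^ ((kummerExp a σ).val * e) * cubeRoot a ^ e)
        = (omega K ^ (m * (kummerExp a σ).val) * omega K ^ ((kummerExp a σ).val * e)) *
            (g * cubeRoot a ^ e) := by ring
      _ = g * cubeRoot a ^ e := by rw [hω, one_mul]
  obtain ⟨w, hw⟩ := exists_algebraMap_eq_of_forall_galAut hfix
  refine ⟨w, ?_⟩
  rw [hw, hwt, mul_pow, ← pow_mul, mul_comm e 3, pow_mul, cubeRoot_pow_three, hg3]

/-- **The kernel of `a ↦ [C_a]`.** If the torsor class of `a ∈ K*` vanishes in `H¹(K, E_D)` then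
`a` is, modulo cubes, a value of the `φ`-descent map on a `K`-rational point of
`E' = E_{81c²}`: `a w³ = phiDescent c P'` for some `P' ∈ E'(K)`, `w ∈ K*` — the exactness of
`E'(K) → H¹(K, E_D[φ]) → H¹(K, E_D)` at the place where the descent uses it (for Cassels' curves:
"the kernel consisting of precisely those `m` for which (2) has a rational point", p. 65). Proof: a
coboundary `n_a(σ) T = σ v − v` with `v ∈ E_D[φ]` forces `a ∈ K*³` (`P' = O`); otherwise
`P' = φ(v)` is `Γ_K`-invariant, hence `K`-rational, and `g_{±c}(v) = (y ± 3c)/x`, a cube root of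
`Y(P') ± 9c` on which `σ` acts through `ω^{±n_a(σ)}`, exhibits `Y(P') + 9c` (resp. `(18c)²` at
`P' = −T'`) as `a` times a cube. [cite: Cassels1964ArithmeticVI, p. 65] -/
theorem exists_phiDescent_eq_of_torsorClass_eq_zero {a : K} (ha : a ≠ 0)
    (h0 : torsorClass hc hD ha = 0) :
    ∃ (P : (mordellCurve (81 * c ^ 2)).toAffine.Point) (w : K), w ≠ 0 ∧ phiDescent c P = a * w ^ 3 := by
  obtain ⟨v, hv⟩ := (GaloisRepresentations.oneCocycleClass_eq_zero_iff _ _).mp h0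
  have hv' : ∀ σ : Field.absoluteGaloisGroup K, torsorFun hc hD a σ = σ • v - v := hv
  have hσv := smul_eq_add_of_torsorFun_eq hc hD hv'
  -- the degenerate cases all give cubes
  have cube_case : ∀ j : ZMod 3,
      (∀ σ : Field.absoluteGaloisGroup K, kummerExp a σ = (eps σ - 1) * j) →
      ∃ (P : (mordellCurve (81 * c ^ 2)).toAffine.Point) (w : K), w ≠ 0 ∧ phiDescent c P = a * w ^ 3 := by
    intro j hj
    obtain ⟨b, hb, hab⟩ := exists_eq_cube_of_kummerExp_eq ha hj
    refine ⟨0, b⁻¹, inv_ne_zero hb, ?_⟩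
    rw [phiDescent_zero, hab, inv_pow, mul_inv_cancel₀ (pow_ne_zero 3 hb)]
  have hV := isVeluThreePair_mordell' hc hD
  have hcoc : ∀ σ : Field.absoluteGaloisGroup K, chiT hc hD (kummerExp a σ) = σ • v - v := hv'
  rcases v with _ | ⟨x, y, hxy⟩
  · -- `v = O`: the cocycle vanishes identically
    refine cube_case 0 fun σ => chiT_injective hc hD ?_
    rw [mul_zero, map_zero, hcoc σ]
    change σ • (0 : geomPoints (mordellCurve D)) - 0 = 0
    rw [smul_zero, sub_zero]
  · set v : geomPoints (mordellCurve D) := Affine.Point.some x y hxy with hvdef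
    by_cases hx : x = 0
    · -- `v = ±T`
      rcases hV.some_eq_T_or hxy hx with hP | hP
      · have hP' : v = torsT hc hD := hP
        refine cube_case 1 fun σ => chiT_injective hc hD ?_
        rw [hcoc σ, chiT_eps_sub_one_mul, chiT_one, hP']
      · have hP' : v = -torsT hc hD := hP
        refine cube_case (-1) fun σ => chiT_injective hc hD ?_
        rw [hcoc σ, chiT_eps_sub_one_mul, map_neg, chiT_one, hP', smul_neg]
    · -- the main case: `P' = φ(v)` is rational
      have hφ : ∀ σ : Field.absoluteGaloisGroup K, σ • phiGeom hc hD v = phiGeom hc hD v := fun σ => by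
        rw [← phiGeom_smul, hσv σ, phiGeom_add_nsmul_torsT]
      have hφv : phiGeom hc hD v =
          Affine.Point.some (hV.X x) (hV.Y x y) (hV.nonsingular_image hxy hx) := by
        rw [phiGeom_apply, hvdef, hV.pointFun_some _ hx]
      have hfix : ∀ σ : Field.absoluteGaloisGroup K,
          galAut σ (hV.X x) = hV.X x ∧ galAut σ (hV.Y x y) = hV.Y x y := fun σ => by
        have e := hφ σ
        rw [hφv, smul_geomPoints_some σ _ (nonsingular_galAut σ (hV.nonsingular_image hxy hx))] at e
        exact Affine.Point.some.inj e
      obtain ⟨X₀, hX₀⟩ := exists_algebraMap_eq_of_forall_galAut fun σ => (hfix σ).1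
      obtain ⟨Y₀, hY₀⟩ := exists_algebraMap_eq_of_forall_galAut fun σ => (hfix σ).2
      have hEq' : (mordellCurve (81 * c ^ 2)).toAffine.Equation X₀ Y₀ := by
        have h1 : ((mordellCurve (81 * c ^ 2)).baseChange (AlgebraicClosure K)).toAffine.Equation
            (Algebra.ofId K (AlgebraicClosure K) X₀) (Algebra.ofId K (AlgebraicClosure K) Y₀) := by
          rw [Algebra.ofId_apply, Algebra.ofId_apply, hX₀, hY₀]
          exact hV.equation_image hxy.left hx
        have hinj : Function.Injective (Algebra.ofId K (AlgebraicClosure K)) :=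
          (algebraMap K (AlgebraicClosure K)).injective
        have h2 := ((mordellCurve (81 * c ^ 2)).toAffine.baseChange_equation hinj X₀ Y₀).mp h1
        change ((mordellCurve (81 * c ^ 2)).baseChange K).toAffine.Equation X₀ Y₀ at h2
        rwa [mordellCurve_baseChange, Algebra.algebraMap_self_apply] at h2
      have hc81 : (81 : K) * c ^ 2 ≠ 0 := mul_ne_zero (by norm_num) (pow_ne_zero 2 hc)
      have hns := nonsingular_mordellCurve_of_equation hc81 hEq'
      have hinjK := (algebraMap K (AlgebraicClosure K)).injective
      by_cases hY : Y₀ = -(9 * c)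
      · -- `P' = −T'`: use `g_{−c}`, moved by `ω²`
        have hm : ((-1 : AlgebraicClosure K) * theta K - 1) / 2 = omega K ^ 2 := by
          rw [omega_sq]; ring
        obtain ⟨w, hw⟩ := exists_pow_three_eq_of_coboundary hc hD ha hxy hx hvdef hσv
          (ε := -1) (by norm_num) (fun σ => by rw [map_neg, map_one]) hm (e := 1) rfl
        -- `w³ = (Y₀ − 9c) a = −18 c a`
        have hwK : w ^ 3 = -(18 * c) * a := by
          apply hinjK
          rw [map_pow, hw, pow_one, ← hY₀, hY]
          simp only [cbar, map_mul, map_neg, map_ofNat]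
          ring
        have hw0 : w ≠ 0 := by
          rintro rfl
          have : -(18 * c) * a = 0 := by rw [← hwK]; ring
          exact mul_ne_zero (neg_ne_zero.mpr (mul_ne_zero (by norm_num) hc)) ha this
        refine ⟨Affine.Point.some X₀ Y₀ hns, -(18 * c) / w, div_ne_zero
          (neg_ne_zero.mpr (mul_ne_zero (by norm_num) hc)) hw0, ?_⟩
        rw [phiDescent_some, if_pos hY, div_pow, hwK]
        field_simp
      · -- generic: use `g_{c}`, moved by `ω`
        have hm : ((1 : AlgebraicClosure K) * theta K - 1) / 2 = omega K ^ 1 := by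
          rw [pow_one, one_mul]; rfl
        obtain ⟨w, hw⟩ := exists_pow_three_eq_of_coboundary hc hD ha hxy hx hvdef hσv
          (ε := 1) (by norm_num) (fun σ => by rw [map_one]) hm (e := 2) rfl
        -- `w³ = (Y₀ + 9c) a²`
        have hwK : w ^ 3 = (Y₀ + 9 * c) * a ^ 2 := by
          apply hinjK
          rw [map_pow, hw, ← hY₀]
          simp only [cbar, map_mul, map_add, map_pow, map_ofNat]
          ring
        have hY9 : Y₀ + 9 * c ≠ 0 := fun h => hY (by linear_combination h)
        have hw0 : w ≠ 0 := by
          rintro rfl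
          have : (Y₀ + 9 * c) * a ^ 2 = 0 := by rw [← hwK]; ring
          exact mul_ne_zero hY9 (pow_ne_zero 2 ha) this
        refine ⟨Affine.Point.some X₀ Y₀ hns, w / a, div_ne_zero hw0 ha, ?_⟩
        rw [phiDescent_some, if_neg hY, div_pow, hwK]
        field_simp

end Kernel

end MordellDescent

end Literature.NumberTheory.EllipticCurves

end
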